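import Summits.ResolutionOfSingularities.ResolutionOfSingularities.Theorems.WildConesCampaignW46ForcedAtomPermissible
import Summits.ResolutionOfSingularities.ResolutionOfSingularities.Theorems.WildConesCampaignW46ForcedAtomWitness
import Summits.ResolutionOfSingularities.ResolutionOfSingularities.Theorems.MarkedTransferCampaignW46FiniteExitBoundWitness
import Summits.ResolutionOfSingularities.ResolutionOfSingularities.Theorems.WildConesClassicalRegimesStubMuDropCurve
import HarnessLib

/-!
# [OURS · L1 W4.6, rung (i)] A NON-TRIVIAL FINITE PERMISSIBLE SEQUENCE INSIDE THE FORCED-ATOM REGIME, and the cusp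
# `y^p + x^{p+1}` is RESOLVED BY ONE BLOW-UP of the typed procedure (`Sing(E₁) = ∅`)
# (cell res-hironaka, LADDER-RESOLUTION rung L, D-0089; slot W4.6, seat res-L1-s46-pv-2 gen 3; host route `WildCones`,
# crux `ClassicalRegimes` stmt-ResolutionOfSingularities-16884, `--supports … --as helper`)

HONEST FRAMING. Everything here is OURS: kernel theorems about ONE explicit finite permissible sequence, assembled from
TREE theorems — res-type-008's actual blow-up of the origin of `𝔸²_K` under the cusp `((y^p + x^{p+1})·𝒪, p)`
(`CampaignW46.FinExitWitness.exists_blowupStep`, `isPermissibleCentre_origin`, `Theorems/MarkedTransferCampaignW46FiniteExitBoundWitness.lean`),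
res-L1-s46-pv-13's state (`CuspPlane.*`), the curve case of route `WildCones`' calculus (`WildCones.MuDropCurve.step_apply`,
`clean_step`), and this seat's dictionary (`ForcedAtom.exists_presentation_transform_of_isBlowup`, p523688;
`AtomGerm.transform_mem_pow_iff_multP`; the plane witness `CuspPlane.regime_forcedAtom`, p521837). The manuscript enters
only through the typed CANDIDATE carriers of row 001 and the OURS vocabulary of res-L1-type-o1 (`Regime.forcedAtom`,
`FinPermissibleRun`, `FinLocalExitBound`) and res-L1-s46-pv-1 (`regimePlaneIsolated`); NOTHING here is a statement of
H. Hironaka's manuscript [Hironaka2017]; no FACT-LIST premise. AI review is weaker than expert review.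

## What is proved (`K` algebraically closed of characteristic `p`; companion of `…ForcedAtomExitBound.lean`)

* §1 the one-variable state `−u^{p+1}` has multiplicity `p` (`multP_negPow`), and its successor under ANY step of the
  calculus is the state `−u` (`step_negPow_apply`), which is NOT of multiplicity `p` (`not_multP_step_negPow`,
  `ser_step_negPow_ne_zero`).
* §2 `sing_transform_cusp_eq_empty` — for every blow-up `π₀ : Z₁ → 𝔸²_K` of the origin (ambient datum `A₁` over the same
  base) whose transform has its singular points closed, the transform `E₁` of the cusp `E₀ = ((y^p + x^{p+1})·𝒪, p)` has
  `Sing(E₁) = ∅`: at a singular point the dictionary would present `J₁` by the successor atom `z^p − (−u)`, of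
  multiplicity `p` — absurd. Hence `regime_forcedAtom_transform_cusp`: the blown-up stage lies in `Regime.forcedAtom 1`.
* §3 `exists_finPermissibleRun_len_one_forcedAtom` — a finite §2.1-permissible sequence of length `1` all of whose stages
  lie in `Regime.forcedAtom 1`, from the cusp state, its centre over the origin (res-type-008's pattern, DESIGN POINT (PAD));
  `one_le_of_finLocalExitBound_forcedAtom_clause` — every `β` satisfying the clause of `FinLocalExitBound (Regime.forcedAtom 1)`
  has `1 ≤ β(𝔸²_K, E₀, ξ)`: the effective rung of `…ForcedAtomExitBound.lean` quantifies over genuinely non-trivial sequences.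

References: res-type-008 (p503572), res-L1-s46-pv-13 (p498082), res-L1-s46-pv-5 (`Cusp.transform_cuspCurve`, through
res-type-008), this seat's p516034/p521837/p523688, res-L1-type-o1 p488284/p517839. [folklore]
-/

noncomputable section

-- single-problem summit: the doubled namespace component `ResolutionOfSingularities` is forced
set_option linter.dupNamespace false

open scoped BigOperators Classical
open MvPowerSeries IsLocalRing
open CategoryTheory AlgebraicGeometry TopologicalSpace

namespace Summit.ResolutionOfSingularities.ResolutionOfSingularities.Theorems

namespace CampaignW46.CuspPlane

open Literature.AlgebraicGeometry.Resolution Scheme.IdealSheafData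
open Literature.AlgebraicGeometry.Hironaka2017.S02Preliminaries
open Literature.AlgebraicGeometry.Hironaka2017.SpecOrders
open Literature.AlgebraicGeometry.Hironaka2017.S16Proof
open Literature.AlgebraicGeometry.Hironaka2017.Datum
open WildCones

variable (p : ℕ) (K : Type) [Field K]

/-! ## §1 The calculus: `−u^{p+1}` has multiplicity `p`, its successor `−u` has not -/

/-- The state `−uⁿ`, `p ≤ n`, `p ∤ n`, has multiplicity `p` (`MultP`). [folklore] -/
theorem multP_negPow {n : ℕ} (hpn : p ≤ n) (hn : ¬ p ∣ n) :
    MultP p 1 K (fun A : Fin 1 → ℕ => if A 0 = n then (-1 : K) else 0) := by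
  have hclean : ∀ A : Fin 1 → ℕ, clean p 1 K (fun A : Fin 1 → ℕ => if A 0 = n then (-1 : K) else 0) A ≠ 0 →
      A 0 = n := by
    intro A hA
    by_contra hne
    apply hA
    simp only [clean]
    rw [if_neg hne, ite_self]
  refine ⟨⟨fun _ => n, ?_⟩, fun A hA => ?_⟩
  · simp only [clean]
    rw [if_neg (fun h => hn (h 0)), if_pos trivial]
    exact neg_ne_zero.mpr one_ne_zero
  · rw [Fin.sum_univ_one, hclean A hA]
    exact hpn

variable [Fact p.Prime]

/-- **The successor of `−u^{p+1}` is `−u`**: after any step of the one-variable calculus the coefficient at `u^b` is the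
coefficient of `−u^{p+1}` at `u^{b+p}` (`WildCones.MuDropCurve.step_apply`). [folklore] -/
theorem step_negPow_apply (i : Fin 1) (τ : Fin 1 → K) (B : Fin 1 → ℕ) :
    step p 1 K i τ (fun A : Fin 1 → ℕ => if A 0 = p + 1 then (-1 : K) else 0) B =
      if B 0 = 1 then (-1 : K) else 0 := by
  have hp : p.Prime := Fact.out
  have hn : ¬ p ∣ p + 1 := FinExitWitness.not_dvd_succ p
  rw [MuDropCurve.step_apply (multP_negPow p K (Nat.le_succ p) hn) i τ B]
  simp only [clean]
  by_cases hB : B 0 = 1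
  · have hnot : ¬ ∀ _j : Fin 1, p ∣ B 0 + p := by
      intro h
      have h0 : p ∣ B 0 + p := h 0
      rw [hB, add_comm] at h0
      exact hn h0
    rw [if_pos hB, if_neg hnot, if_pos (by omega)]
  · rw [if_neg hB]
    split_ifs with h1 h2
    · rfl
    · exfalso; apply hB; omega
    · rfl

/-- The successor `−u` is NOT of multiplicity `p` (its cleaned monomial `u` has degree `1 < p`). [folklore] -/
theorem not_multP_step_negPow (i : Fin 1) (τ : Fin 1 → K) :
    ¬ MultP p 1 K (step p 1 K i τ (fun A : Fin 1 → ℕ => if A 0 = p + 1 then (-1 : K) else 0)) := by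
  intro h
  have hp : p.Prime := Fact.out
  have h1 := h.2 (fun _ => 1) (by
    rw [MuDropCurve.clean_step, step_negPow_apply p K i τ, if_pos rfl]
    exact neg_ne_zero.mpr one_ne_zero)
  rw [Fin.sum_univ_one] at h1
  exact absurd (lt_of_lt_of_le hp.one_lt h1) (lt_irrefl 1)

/-- The cleaned series of the successor `−u` is non-zero. [folklore] -/
theorem ser_step_negPow_ne_zero (i : Fin 1) (τ : Fin 1 → K) :
    ser p 1 K (step p 1 K i τ (fun A : Fin 1 → ℕ => if A 0 = p + 1 then (-1 : K) else 0)) ≠ 0 := by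
  intro h
  have h1 := congrArg (MvPowerSeries.coeff (Finsupp.single (0 : Fin 1) 1)) h
  rw [map_zero] at h1
  apply (neg_ne_zero.mpr (one_ne_zero (α := K)))
  rw [← h1]
  change _ = clean p 1 K (step p 1 K i τ (fun A : Fin 1 → ℕ => if A 0 = p + 1 then (-1 : K) else 0))
    ⇑(Finsupp.single (0 : Fin 1) 1)
  rw [MuDropCurve.clean_step, step_negPow_apply p K i τ, Finsupp.single_eq_same, if_pos rfl]

/-! ## §2 The blown-up stage: the cusp is resolved by one blow-up -/

variable [CharP K p]

/-- The presentation of `J_ξ = ((y/1)^p + (x/1)^{p+1})` at the origin of the plane by the EXPLICIT state `−u^{p+1}`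
(unit `1`, Cohen coordinates `y ↦ z`, `x ↦ u`). [folklore] -/
theorem exists_presentation_cusp :
    ∃ (E₀ : AdicCompletion (maximalIdeal ((U82Gap.Z K).presheaf.stalk (U82Gap.ξ K)))
        ((U82Gap.Z K).presheaf.stalk (U82Gap.ξ K)) ≃+* MvPowerSeries (Option (Fin 1)) K),
      E₀ (algebraMap _ _ (U82Gap.cAt (U82Gap.ξ K) 0 ^ p + 1 * U82Gap.cAt (U82Gap.ξ K) 1 ^ (p + 1))) =
        1 * ((MvPowerSeries.X none : MvPowerSeries (Option (Fin 1)) K) ^ p -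
          rename (some : Fin 1 → Option (Fin 1))
            (ser p 1 K (fun A : Fin 1 → ℕ => if A 0 = p + 1 then (-1 : K) else 0))) := by
  obtain ⟨E₀, h0, h1⟩ := exists_presentation_origin p K
  refine ⟨E₀, ?_⟩
  simp only [map_add, map_pow, h0, h1, ser_negPow p K (FinExitWitness.not_dvd_succ p), map_neg, rename_X, one_mul,
    sub_neg_eq_add]

variable [IsAlgClosed K]

/-- [OURS · L1 W4.6 rung (i); NOT a statement of the manuscript] **The cusp `y^p + x^{p+1}` is resolved by ONE blow-up of
the typed procedure.** For every blow-up `π₀ : Z₁ → 𝔸²_K` of the origin carrying an ambient datum `A₁` over the same base,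
if the singular points of the transform `E₁` of `E₀ = ((y^p + x^{p+1})·𝒪, p)` are closed then `Sing(E₁) = ∅`: at a
singular point the dictionary presents `J₁` by the successor atom `z^p − (−u)`, which would have multiplicity `p`.
(`K` algebraically closed.) [folklore] -/
theorem sing_transform_cusp_eq_empty (A₁ : AmbientDatum p K) (π₀ : A₁.Z ⟶ (U82Gap.amb p K).Z)
    (hhom : A₁.hom = π₀ ≫ (U82Gap.amb p K).hom)
    (hπ : IsBlowup π₀ (vanishingIdeal (⟨{U82Gap.ξ K}, U82Gap.ξ_isClosed K⟩ : Closeds (U82Gap.amb p K).Z)))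
    (hcl : ((⟨shf (MvPolynomial (Fin 2) K) (Ideal.span {MvPolynomial.X 1 ^ p + MvPolynomial.X 0 ^ (p + 1)}), p⟩ :
        IdealExponent (U82Gap.amb p K).Z).transform π₀ ⟨{U82Gap.ξ K}, U82Gap.ξ_isClosed K⟩).sing ⊆
        Literature.AlgebraicGeometry.Hironaka2017.S02Preliminaries.closedPoints A₁.Z) :
    ((⟨shf (MvPolynomial (Fin 2) K) (Ideal.span {MvPolynomial.X 1 ^ p + MvPolynomial.X 0 ^ (p + 1)}), p⟩ :
        IdealExponent (U82Gap.amb p K).Z).transform π₀ ⟨{U82Gap.ξ K}, U82Gap.ξ_isClosed K⟩).sing = ∅ := by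
  have hp : p.Prime := Fact.out
  have hn : ¬ p ∣ p + 1 := FinExitWitness.not_dvd_succ p
  rw [Set.eq_empty_iff_forall_notMem]
  intro ξ' hξ'
  haveI : IsRegularLocalRing (A₁.Z.presheaf.stalk ξ') := ambient_isRegular A₁ _
  -- the presentation of stage 0 at the origin by `−u^{p+1}`
  obtain ⟨E₀, hf₀⟩ := exists_presentation_cusp p K
  have hS₀ : ((⟨shf (MvPolynomial (Fin 2) K) (Ideal.span {MvPolynomial.X 1 ^ p + MvPolynomial.X 0 ^ (p + 1)}), p⟩ :
      IdealExponent (U82Gap.amb p K).Z).sing).Subsingleton := by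
    change (⟨shf (MvPolynomial (Fin 2) K) (Ideal.span {MvPolynomial.X 1 ^ p + MvPolynomial.X 0 ^ (p + 1)}), p⟩ :
        IdealExponent (U82Gap.Z K)).sing.Subsingleton
    rw [sing_eq p K (Nat.le_succ p) hn]
    exact Set.subsingleton_singleton
  have hξ₀ : U82Gap.ξ K ∈ ((⟨shf (MvPolynomial (Fin 2) K)
      (Ideal.span {MvPolynomial.X 1 ^ p + MvPolynomial.X 0 ^ (p + 1)}), p⟩ : IdealExponent (U82Gap.amb p K).Z).sing) :=
    (mem_sing_iff p K (Nat.le_succ p) hn (U82Gap.ξ K)).mpr rfl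
  have hd : (maximalIdeal ((U82Gap.amb p K).Z.presheaf.stalk (U82Gap.ξ K))).spanFinrank = 1 + 1 := by
    change (maximalIdeal ((U82Gap.Z K).presheaf.stalk (U82Gap.ξ K))).spanFinrank = 1 + 1
    rw [U82Gap.spanFinrank_maximalIdeal_stalk rfl]
  -- the one step of the dictionary at `ξ′`
  obtain ⟨i₀, t, E₁, f₁, w₁, hJ₁, hw₁, hf₁⟩ := ForcedAtom.exists_presentation_transform_of_isBlowup π₀
    ⟨{U82Gap.ξ K}, U82Gap.ξ_isClosed K⟩ hπ hhom rfl hS₀ hξ₀ rfl hd E₀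
    (U82Gap.cAt (U82Gap.ξ K) 0 ^ p + 1 * U82Gap.cAt (U82Gap.ξ K) 1 ^ (p + 1) :
      (U82Gap.Z K).presheaf.stalk (U82Gap.ξ K))
    (fun A : Fin 1 → ℕ => if A 0 = p + 1 then (-1 : K) else 0) 1 (stalkIdeal_eq_span p K (p + 1) (U82Gap.ξ K))
    isUnit_one hf₀ (multP_negPow p K (Nat.le_succ p) hn) hξ' (hcl hξ')
  -- `f₁ ∈ 𝔪^p` since `ξ′` is singular, hence the successor would have multiplicity `p`
  have hf₁𝔪 : f₁ ∈ maximalIdeal (A₁.Z.presheaf.stalk ξ') ^ p := by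
    have h := hξ'
    change ((p : ℕ) : ℕ∞) ≤ idealOrder _ _ at h
    rw [le_idealOrder_iff, hJ₁, Ideal.span_singleton_le_iff_mem] at h
    exact h
  exact not_multP_step_negPow p K i₀ t
    ((AtomGerm.transform_mem_pow_iff_multP E₁ hw₁ _ hf₁).2.mpr ⟨ser_step_negPow_ne_zero p K i₀ t, hf₁𝔪⟩)

/-- [OURS · L1 W4.6 rung (i); NOT a statement of the manuscript] **The blown-up stage lies in the forced-atom regime**:
under the hypotheses of `sing_transform_cusp_eq_empty`, `Regime.forcedAtom 1 A₁ E₁` (its singular locus is empty).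
[folklore] -/
theorem regime_forcedAtom_transform_cusp (A₁ : AmbientDatum p K) (π₀ : A₁.Z ⟶ (U82Gap.amb p K).Z)
    (hhom : A₁.hom = π₀ ≫ (U82Gap.amb p K).hom)
    (hπ : IsBlowup π₀ (vanishingIdeal (⟨{U82Gap.ξ K}, U82Gap.ξ_isClosed K⟩ : Closeds (U82Gap.amb p K).Z)))
    (hcl : ((⟨shf (MvPolynomial (Fin 2) K) (Ideal.span {MvPolynomial.X 1 ^ p + MvPolynomial.X 0 ^ (p + 1)}), p⟩ :
        IdealExponent (U82Gap.amb p K).Z).transform π₀ ⟨{U82Gap.ξ K}, U82Gap.ξ_isClosed K⟩).sing ⊆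
        Literature.AlgebraicGeometry.Hironaka2017.S02Preliminaries.closedPoints A₁.Z) :
    Regime.forcedAtom (p := p) (K := K) 1 A₁
      ((⟨shf (MvPolynomial (Fin 2) K) (Ideal.span {MvPolynomial.X 1 ^ p + MvPolynomial.X 0 ^ (p + 1)}), p⟩ :
        IdealExponent (U82Gap.amb p K).Z).transform π₀ ⟨{U82Gap.ξ K}, U82Gap.ξ_isClosed K⟩) := by
  refine ⟨rfl, ?_, fun ξ hξ => ?_⟩
  · rw [sing_transform_cusp_eq_empty p K A₁ π₀ hhom hπ hcl]
    exact Set.subsingleton_empty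
  · rw [sing_transform_cusp_eq_empty p K A₁ π₀ hhom hπ hcl] at hξ
    exact absurd hξ (Set.notMem_empty ξ)

/-! ## §3 A length-one permissible sequence inside the forced-atom regime -/

/-- [OURS · L1 W4.6 rung (i) — RUN WITNESS; NOT a statement of the manuscript] **A non-trivial finite §2.1-permissible
sequence inside `Regime.forcedAtom 1`** (`K` algebraically closed of characteristic `p`): a `FinPermissibleRun` of length
`1` from the cusp state `(𝔸²_K, ((y^p + x^{p+1})·𝒪, p))`, all of whose stages `0, 1` lie in `Regime.forcedAtom 1`, whose
centre (the origin, blown up by an ACTUAL blow-up, res-type-008) meets the fibre over the singular point `ξ`: the finset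
`s = {0}` satisfies the hypothesis of the clause of `FinLocalExitBound` at `x = ξ`. [folklore] -/
theorem exists_finPermissibleRun_len_one_forcedAtom :
    ∃ r : FinPermissibleRun p K,
      (⟨r.A 0, r.E 0⟩ : Σ A : AmbientDatum p K, IdealExponent A.Z) =
          ⟨U82Gap.amb p K, ⟨shf (MvPolynomial (Fin 2) K)
            (Ideal.span {MvPolynomial.X 1 ^ p + MvPolynomial.X 0 ^ (p + 1)}), p⟩⟩ ∧
      r.len = 1 ∧ (∀ k, k ≤ r.len → Regime.forcedAtom (p := p) (K := K) 1 (r.A k) (r.E k)) ∧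
        ∃ x : (r.A 0).Z, x ∈ (r.E 0).sing ∧
          ∀ m ∈ ({0} : Finset ℕ), m < r.len ∧ ∃ y ∈ (r.D m : Set (r.A m).Z), r.down m y = x := by
  haveI : PerfectRing K p := PerfectField.toPerfectRing p
  have hn : ¬ p ∣ p + 1 := FinExitWitness.not_dvd_succ p
  obtain ⟨A₁, π₀, hhom, hπ, hstd₁, hRg₁, -⟩ := FinExitWitness.exists_blowupStep p K
  have hcl₁ := ((regimePlaneIsolated_iff A₁ _).mp hRg₁).2.2
  refine
    ⟨{ len := 1
       A := fun k => match k with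
         | 0 => U82Gap.amb p K
         | _ + 1 => A₁
       E := fun k => match k with
         | 0 => ⟨shf (MvPolynomial (Fin 2) K) (Ideal.span {MvPolynomial.X 1 ^ p + MvPolynomial.X 0 ^ (p + 1)}), p⟩
         | _ + 1 =>
           (⟨shf (MvPolynomial (Fin 2) K) (Ideal.span {MvPolynomial.X 1 ^ p + MvPolynomial.X 0 ^ (p + 1)}), p⟩ :
               IdealExponent (U82Gap.amb p K).Z).transform π₀ ⟨{U82Gap.ξ K}, U82Gap.ξ_isClosed K⟩
       D := fun k => match k with
         | 0 => ⟨{U82Gap.ξ K}, U82Gap.ξ_isClosed K⟩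
         | _ + 1 => ⊥
       π := fun k => match k with
         | 0 => π₀
         | _ + 1 => 𝟙 A₁.Z
       standard := fun k hk => by
         interval_cases k
         · exact FinExitWitness.isStandard_stage0 p K
         · exact hstd₁
       permissible := fun k hk => by
         obtain rfl : k = 0 := by omega
         exact FinExitWitness.isPermissibleCentre_origin p K
       hom_eq := fun k hk => by
         obtain rfl : k = 0 := by omega
         exact hhom
       blowup := fun k hk => by
         obtain rfl : k = 0 := by omega
         exact hπ
       E_succ := fun k hk => by
         obtain rfl : k = 0 := by omega
         rfl },
      rfl, rfl, ?_, U82Gap.ξ K, ?_, ?_⟩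
  · intro k hk
    interval_cases k
    · exact regime_forcedAtom p K (Nat.le_succ p) hn
    · exact regime_forcedAtom_transform_cusp p K A₁ π₀ hhom hπ hcl₁
  · change U82Gap.ξ K ∈
        (⟨shf (MvPolynomial (Fin 2) K) (Ideal.span {MvPolynomial.X 1 ^ p + MvPolynomial.X 0 ^ (p + 1)}), p⟩ :
          IdealExponent (U82Gap.amb p K).Z).sing
    rw [FinExitWitness.sing_stage0 p K]
    rfl
  · intro m hm
    obtain rfl : m = 0 := by simpa using hm
    exact ⟨Nat.zero_lt_one, U82Gap.ξ K, rfl, rfl⟩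

/-- [OURS · L1 W4.6 rung (i); NOT a statement of the manuscript] **The exit-bound clause of the forced-atom rung is not
about length-0 sequences only**: every `β(A, E, x)` satisfying the clause of `FinLocalExitBound (Regime.forcedAtom 1)`
has `1 ≤ β(𝔸²_K, ((y^p + x^{p+1})·𝒪, p), ξ)` (apply the clause to the length-1 sequence above with `s = {0}`). In
particular the `β` of `ForcedAtom.finLocalExitBound_forcedAtom` (`…ForcedAtomExitBound.lean`) is positive there.
(`K` algebraically closed.) [folklore] -/
theorem one_le_of_finLocalExitBound_forcedAtom_clause
    (β : ∀ A : AmbientDatum p K, IdealExponent A.Z → A.Z → ℕ)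
    (hβ : ∀ r : FinPermissibleRun p K, (∀ k, k ≤ r.len → Regime.forcedAtom (p := p) (K := K) 1 (r.A k) (r.E k)) →
      ∀ (x : (r.A 0).Z) (s : Finset ℕ),
        (∀ m ∈ s, m < r.len ∧ ∃ y ∈ (r.D m : Set (r.A m).Z), r.down m y = x) → s.card ≤ β (r.A 0) (r.E 0) x) :
    1 ≤ β (U82Gap.amb p K)
      ⟨shf (MvPolynomial (Fin 2) K) (Ideal.span {MvPolynomial.X 1 ^ p + MvPolynomial.X 0 ^ (p + 1)}), p⟩
      (U82Gap.ξ K) := by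
  haveI : PerfectRing K p := PerfectField.toPerfectRing p
  have hn : ¬ p ∣ p + 1 := FinExitWitness.not_dvd_succ p
  obtain ⟨A₁, π₀, hhom, hπ, hstd₁, hRg₁, -⟩ := FinExitWitness.exists_blowupStep p K
  have hcl₁ := ((regimePlaneIsolated_iff A₁ _).mp hRg₁).2.2
  let r : FinPermissibleRun p K :=
    { len := 1
      A := fun k => match k with
        | 0 => U82Gap.amb p K
        | _ + 1 => A₁
      E := fun k => match k with
        | 0 => ⟨shf (MvPolynomial (Fin 2) K) (Ideal.span {MvPolynomial.X 1 ^ p + MvPolynomial.X 0 ^ (p + 1)}), p⟩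
        | _ + 1 =>
          (⟨shf (MvPolynomial (Fin 2) K) (Ideal.span {MvPolynomial.X 1 ^ p + MvPolynomial.X 0 ^ (p + 1)}), p⟩ :
              IdealExponent (U82Gap.amb p K).Z).transform π₀ ⟨{U82Gap.ξ K}, U82Gap.ξ_isClosed K⟩
      D := fun k => match k with
        | 0 => ⟨{U82Gap.ξ K}, U82Gap.ξ_isClosed K⟩
        | _ + 1 => ⊥
      π := fun k => match k with
        | 0 => π₀
        | _ + 1 => 𝟙 A₁.Z
      standard := fun k hk => by
        interval_cases k
        · exact FinExitWitness.isStandard_stage0 p K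
        · exact hstd₁
      permissible := fun k hk => by
        obtain rfl : k = 0 := by omega
        exact FinExitWitness.isPermissibleCentre_origin p K
      hom_eq := fun k hk => by
        obtain rfl : k = 0 := by omega
        exact hhom
      blowup := fun k hk => by
        obtain rfl : k = 0 := by omega
        exact hπ
      E_succ := fun k hk => by
        obtain rfl : k = 0 := by omega
        rfl }
  have hreg : ∀ k, k ≤ r.len → Regime.forcedAtom (p := p) (K := K) 1 (r.A k) (r.E k) := by
    intro k hk
    change k ≤ 1 at hk
    interval_cases k
    · exact regime_forcedAtom p K (Nat.le_succ p) hn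
    · exact regime_forcedAtom_transform_cusp p K A₁ π₀ hhom hπ hcl₁
  have key := hβ r hreg (U82Gap.ξ K) {0} fun m hm => by
    obtain rfl : m = 0 := by simpa using hm
    exact ⟨Nat.zero_lt_one, U82Gap.ξ K, rfl, rfl⟩
  simpa using key

/-- [OURS · L1 W4.6 rung (i); NOT a statement of the manuscript] **The witness of the effective forced-atom rung is
positive at the cusp**: `FinLocalExitBound (Regime.forcedAtom 1)` holds over an algebraically closed `K` with SOME `β`
(this seat's `…ForcedAtomExitBound.lean`), and EVERY such `β` is `≥ 1` at the cusp state. [folklore] -/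
theorem exists_one_le_of_finLocalExitBound_forcedAtom
    (h : FinLocalExitBound (Regime.forcedAtom (p := p) (K := K) 1)) :
    ∃ β : ∀ A : AmbientDatum p K, IdealExponent A.Z → A.Z → ℕ,
      (∀ r : FinPermissibleRun p K, (∀ k, k ≤ r.len → Regime.forcedAtom (p := p) (K := K) 1 (r.A k) (r.E k)) →
        ∀ (x : (r.A 0).Z) (s : Finset ℕ),
          (∀ m ∈ s, m < r.len ∧ ∃ y ∈ (r.D m : Set (r.A m).Z), r.down m y = x) → s.card ≤ β (r.A 0) (r.E 0) x) ∧
      1 ≤ β (U82Gap.amb p K)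
        ⟨shf (MvPolynomial (Fin 2) K) (Ideal.span {MvPolynomial.X 1 ^ p + MvPolynomial.X 0 ^ (p + 1)}), p⟩
        (U82Gap.ξ K) := by
  obtain ⟨β, hβ⟩ := h
  exact ⟨β, hβ, one_le_of_finLocalExitBound_forcedAtom_clause p K β hβ⟩

end CampaignW46.CuspPlane

end Summit.ResolutionOfSingularities.ResolutionOfSingularities.Theorems

end
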